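import Summits.CriticalPhenomena.PercolationContinuityZ3.Theorems.PercNearOneGluingNoHeavyPcintNawFreeZ5F10Defs
import HarnessLib

/-!
# PCINT lane, kernel reduced-state B2d (`nawfree`) certificate `Z5F10` (d = 5, memory τ = 10, delay kt = 4, 798 state classes): row checks 4 (rows [720, 798))

Cell `prim-pcint`, seat `prim-pcint-1` (gen 6); memo `run/shared/lean/prim/pcint/REDUCTIONS.md` §B2d (delayed chain payments with
free-neighbour shares).  Does NOT build on p205010.  Data for `NawK.le_siteCriticalProb_of_checkRowsF` (`…PcintNawFreeMemKernelCert`):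
`p = 12690/100000`, weight table `Q_k/100000`, `Q = [87310, 87310, 93440, 95578, 96665, 97323, 97764, 98081, 98318, 98504, 98653]` (`Q_k^k·100000 ≥ (100000-12690)·100000^k`, nondecreasing), `λ = 99999/100000`; Collatz–Wielandt
weights (scale 10⁹) from a power iteration, exact off-line max row ratio 0.9993694106 < λ.  Generated by work/gen6/gen_free.py
(pcint-1 gen 6 folder); the kernel re-checks every row.
-/

namespace Summit.CriticalPhenomena.PercolationContinuityZ3.Theorems.Pcint.NawFreeZ5F10

set_option maxHeartbeats 0 in
/-- Rows `[720, 750)` pass the check. [folklore] -/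
theorem chk_720 : WinK.allRange (NawK.checkRowF 10 4 5 798 12690 100000 99999 100000 NawFreeZ5F10.QL NawFreeZ5F10.syms NawFreeZ5F10.tree) 720 750 = true :=
  WinK.allRange_of_allRangeB (fuel := 8) (lo := 720) (len := 30) (by decide +kernel)

set_option maxHeartbeats 0 in
/-- Rows `[750, 780)` pass the check. [folklore] -/
theorem chk_750 : WinK.allRange (NawK.checkRowF 10 4 5 798 12690 100000 99999 100000 NawFreeZ5F10.QL NawFreeZ5F10.syms NawFreeZ5F10.tree) 750 780 = true :=
  WinK.allRange_of_allRangeB (fuel := 8) (lo := 750) (len := 30) (by decide +kernel)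

set_option maxHeartbeats 0 in
/-- Rows `[780, 798)` pass the check. [folklore] -/
theorem chk_780 : WinK.allRange (NawK.checkRowF 10 4 5 798 12690 100000 99999 100000 NawFreeZ5F10.QL NawFreeZ5F10.syms NawFreeZ5F10.tree) 780 798 = true :=
  WinK.allRange_of_allRangeB (fuel := 8) (lo := 780) (len := 18) (by decide +kernel)

/-- Rows `[720, 798)` pass the check. [folklore] -/
theorem file_4 : WinK.allRange (NawK.checkRowF 10 4 5 798 12690 100000 99999 100000 NawFreeZ5F10.QL NawFreeZ5F10.syms NawFreeZ5F10.tree) 720 798 = true := (WinK.allRange_split (WinK.allRange_split chk_720 chk_750) chk_780)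

end Summit.CriticalPhenomena.PercolationContinuityZ3.Theorems.Pcint.NawFreeZ5F10
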